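import Summits.CriticalPhenomena.PercolationContinuityZ3.Theorems.Transplant.FKConnectivityAllQApexHubCyl
import HarnessLib

/-!
# Connectivity correlation inequalities for `φ_{w,q}`, every `q > 0` — THE ANTIPODAL (POLAR) REDUCTION OF THE HUB INEQUALITY:
# definitions (pattern events, the weight-free antipodal sum `T`, one conjecture node) and the reduction theorems

Definitions + theorems file (`--supports stmt-CriticalPhenomena-4575`), census lineage `prim-bschramm-census` (gen 25) of the
post-continuity programme; builds on p205010 (kernel theorem, internal audit signed; external expert review pending).  One
`@[conjecture]` node (`AntipodalTPos`, NOT asserted); no named facts, no sorries; standard axioms.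

THE STATEMENT REDUCED.  For `μ = φ_{w,q}` and three vertices `z, s, t`, the five PATTERN EVENTS are the partitions the open clusters
induce on `{z,s,t}`: `patSep` (pairwise separated), `patST` (`s ↔ t` only), `patZS`, `patZT`, `patAll`.  The quantity
`δ := S(patSep)·S(patAll) − S(patST)·(S(patZS) + S(patZT))` (masses `S(A) = ∑_ω w_q(ω) 1_A(ω)`) is nonnegative iff `{s ↔ t}` and
`{z ↔ s} ∪ {z ↔ t}` are positively correlated; `δ ≥ 0` implies Ayyer–Linusson–Ravichandran's hub inequality (14)/(13)
`φ(z ↔ s)φ(t ↔ s) ≤ φ(z ↔ s ↔ t)` (`HubUnder μ z s t`), which for `q ≥ 1` is FKG and for `q < 1` is open in print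
("even for the arboreal gas", arXiv:2509.18788 §7 p. 22).

THE REDUCTION (this file).  `δ` is a quadratic form of the law and the law is multi-affine in the parameters; grouping the pairs of
configurations `(ω, ω')` by `F = ω Δ ω'`, `ρ = ω ∩ ω'` gives the exact identity (`FK.two_mul_deltaMass_eq_sum_antipodal`)
`2δ = ∑_{F, ρ disjoint} c_w(F,ρ) · T_q(z,s,t; F, ρ)`, `c_w(F,ρ) = ∏_{e∈F} w_e(1−w_e) ∏_{e∈ρ} w_e² ∏_{e∉F∪ρ} (1−w_e)² ≥ 0`, with the
WEIGHT-FREE antipodal sum `T_q(F,ρ) = ∑_{X ⊆ F} q^{k(ρ∪X)+k(ρ∪(F∖X))}·Q(ρ∪X, ρ∪(F∖X))` (`FK.antipodalT`; `Q` = the polar form of `δ` on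
pattern indicators, `FK.antipodalQ`) — `T_q(F,ρ)` is the antipodal sum of the minor "contract `ρ`, keep `F`, delete the rest".  Hence
(`FK.deltaMass_nonneg_of_antipodalTOn`, `FK.hubUnder_of_antipodalTOn`, `FK.hubFKPos_of_antipodalTPos`):
**if `T_q ≥ 0` for all `z,s,t,F,ρ` on a vertex type (`AntipodalTOn V q`) then `δ ≥ 0` and the hub inequality hold for EVERY weight
vector on `V`; `AntipodalTPos → HubFKPos`.**  EVIDENCE for the node (census gen 25, memo bschramm/FROM-census-g25-ANTIPODAL-T.md):
`T` is coefficientwise nonnegative in `q` (graded by `k(X)+k(F∖X)`) in EVERY instance on all connected graphs with `≤ 8` vertices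
(1,403,621 nontrivial (graph, triple) instances, two independent exact engines) — so, by this file, (14)/(13) hold at every hub of every
weighted graph on `≤ 8` vertices for every `q > 0`; multigraph minors reduce to simple ones (`T(G+e∥) = T(G)+2T(G/e)`).
[cite: AyyerLinussonRavichandran2025, §7 eq. (13)–(15), Conj. 7.1 (p. 22)] [cite: Grimmett2006, §1.4 eq. (1.20) (p. 15); §3.9 (p. 63)]
-/

noncomputable section

namespace Summit.CriticalPhenomena.PercolationContinuityZ3.Theorems

namespace FK

open MeasureTheory Set Literature.Probability.LatticeModels Literature.Probability.Percolation
open Literature.Probability.Percolation.BHK2006 (weight weight_nonneg)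
open Literature.Probability.Percolation.DecisionTree (ind ind_of_mem ind_of_not_mem ind_nonneg)
open scoped Classical

variable {V : Type*} [Fintype V]

/-! ### Pattern events of three vertices -/

/-- `patSep z s t`: the clusters separate `z, s, t` pairwise. [cite: AyyerLinussonRavichandran2025, §7 (p. 22)] -/
def patSep (z s t : V) : Set (BondConfig V) := (openConn z s)ᶜ ∩ (openConn z t)ᶜ ∩ (openConn s t)ᶜ

/-- `patST z s t`: `s ↔ t` and `z` is in another cluster. [cite: AyyerLinussonRavichandran2025, §7 (p. 22)] -/
def patST (z s t : V) : Set (BondConfig V) := openConn s t ∩ (openConn z s)ᶜ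

/-- `patZS z s t`: `z ↔ s` and `t` is in another cluster. [cite: AyyerLinussonRavichandran2025, §7 (p. 22)] -/
def patZS (z s t : V) : Set (BondConfig V) := openConn z s ∩ (openConn z t)ᶜ

/-- `patZT z s t`: `z ↔ t` and `s` is in another cluster. [cite: AyyerLinussonRavichandran2025, §7 (p. 22)] -/
def patZT (z s t : V) : Set (BondConfig V) := openConn z t ∩ (openConn z s)ᶜ

/-- `patAll z s t`: `z, s, t` are all connected. [cite: AyyerLinussonRavichandran2025, §7 (p. 22)] -/
def patAll (z s t : V) : Set (BondConfig V) := openConn z s ∩ openConn z t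

/-- The polar form of `δ = S(sep)S(all) − S(st)(S(zs)+S(zt))` on the pattern indicators of two configurations:
`Q(ω,ω') = 1_sep(ω)1_all(ω') + 1_all(ω)1_sep(ω') − 1_st(ω)(1_zs+1_zt)(ω') − 1_st(ω')(1_zs+1_zt)(ω)`. [folklore] -/
def antipodalQ (z s t : V) (ω ω' : BondConfig V) : ℝ :=
  ind (patSep z s t) ω * ind (patAll z s t) ω' + ind (patAll z s t) ω * ind (patSep z s t) ω'
    - ind (patST z s t) ω * (ind (patZS z s t) ω' + ind (patZT z s t) ω')
    - ind (patST z s t) ω' * (ind (patZS z s t) ω + ind (patZT z s t) ω)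

/-- **The weight-free antipodal sum** of the minor "contract `ρ`, keep `F`":
`T_q(z,s,t;F,ρ) = ∑_{X ⊆ F} q^{k(ρ ∪ X) + k(ρ ∪ (F ∖ X))} · Q(ρ ∪ X, ρ ∪ (F ∖ X))` (free cluster counts on `V`).
[cite: AyyerLinussonRavichandran2025, §7 (p. 22)] -/
def antipodalT (q : ℝ) (z s t : V) (F ρ : BondConfig V) : ℝ :=
  ∑ X : BondConfig V, if X ⊆ F then
    q ^ (clusterCount (ρ ∪ X) ∅ + clusterCount (ρ ∪ (F \ X)) ∅) * antipodalQ z s t (ρ ∪ X) (ρ ∪ (F \ X)) else 0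

/-- **Antipodal nonnegativity on the vertex type `V` at `q`**: `T_q(z,s,t;F,ρ) ≥ 0` for all vertices and all disjoint `F, ρ`
(i.e. for every minor of the complete graph on `V`; coincident terminals give `T = 0`). [cite: AyyerLinussonRavichandran2025, §7 (p. 22)] -/
def AntipodalTOn (V : Type*) [Fintype V] (q : ℝ) : Prop :=
  ∀ (z s t : V) (F ρ : BondConfig V), Disjoint F ρ → 0 ≤ antipodalT q z s t F ρ

/-- Antipodal nonnegativity on every `Fin n`. [cite: AyyerLinussonRavichandran2025, §7 (p. 22)] -/
def AntipodalTFK (q : ℝ) : Prop := ∀ n : ℕ, AntipodalTOn (Fin n) q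

/-- **CONJECTURE T (census gen 25) — antipodal nonnegativity for every `q > 0`.**  CONJECTURE-SHAPED STATEMENT, NOT asserted.
Combinatorial content: among the antipodal pairs `(X, F∖X)` of a (multi)graph, weighted by `q^{k(X)+k(F∖X)}`, the pairs in which one
side separates `z,s,t` pairwise and the other connects all three outweigh the pairs in which `X ⊇ (s~t only)` and `F∖X ⊇ (z~s only)`
or `(z~t only)`.  Evidence: coefficientwise in the grade on every connected graph with `≤ 8` vertices (census gen 25; 0 exceptions in
1,403,621 nontrivial instances).  By `hubFKPos_of_antipodalTPos` it implies `HubFKPos` (ALR (13)/(14) for every `q > 0`).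
[cite: AyyerLinussonRavichandran2025, §7 eq. (13)–(15), Conj. 7.1 (p. 22)] [cite: Grimmett2006, §3.9 (p. 63)] -/
@[conjecture] def AntipodalTPos : Prop := ∀ q : ℝ, 0 < q → AntipodalTFK q

/-! ### Masses -/

/-- The mass `S_w(A) = ∑_ω w_q(ω) 1_A(ω)` (free boundary). [cite: Grimmett2006, §1.4 eq. (1.20) (p. 15)] -/
def patMass (w : Sym2 V → unitInterval) (q : ℝ) (A : Set (BondConfig V)) : ℝ :=
  ∑ ω : BondConfig V, rcWeightW w q ∅ ω * ind A ω

/-- `δ_w = S(sep)·S(all) − S(st)·(S(zs) + S(zt))`. [cite: AyyerLinussonRavichandran2025, §7 (p. 22)] -/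
def deltaMass (w : Sym2 V → unitInterval) (q : ℝ) (z s t : V) : ℝ :=
  patMass w q (patSep z s t) * patMass w q (patAll z s t) - patMass w q (patST z s t) * (patMass w q (patZS z s t) + patMass w q (patZT z s t))

/-- The coefficient `c_w(F,ρ) = ∏_{e∈F} w_e(1−w_e) · ∏_{e∈ρ} w_e² · ∏_{e∉F∪ρ} (1−w_e)²`. [folklore] -/
def antipodalCoef (w : Sym2 V → unitInterval) (F ρ : BondConfig V) : ℝ :=
  ∏ e : Sym2 V, if e ∈ F then (w e : ℝ) * (1 - w e) else if e ∈ ρ then (w e : ℝ) ^ 2 else (1 - (w e : ℝ)) ^ 2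

variable (w : Sym2 V → unitInterval)

/-- `c_w(F,ρ) ≥ 0`. [folklore] -/
theorem antipodalCoef_nonneg (F ρ : BondConfig V) : 0 ≤ antipodalCoef w F ρ := by
  unfold antipodalCoef
  refine Finset.prod_nonneg fun e _ => ?_
  have h0 : 0 ≤ (w e : ℝ) := (w e).2.1
  have h1 : (w e : ℝ) ≤ 1 := (w e).2.2
  split_ifs
  · exact mul_nonneg h0 (by linarith)
  · positivity
  · positivity

/-! ### Step 1: `2δ` as a double sum of the polar form -/

/-- `2δ_w = ∑_ω ∑_{ω'} w_q(ω) w_q(ω') Q(ω, ω')`. [folklore] -/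
theorem two_mul_deltaMass_eq_double_sum (q : ℝ) (z s t : V) :
    2 * deltaMass w q z s t =
      ∑ ω : BondConfig V, ∑ ω' : BondConfig V, rcWeightW w q ∅ ω * rcWeightW w q ∅ ω' * antipodalQ z s t ω ω' := by
  set a : BondConfig V → ℝ := fun ω => rcWeightW w q ∅ ω * ind (patSep z s t) ω with ha
  set b : BondConfig V → ℝ := fun ω => rcWeightW w q ∅ ω * ind (patAll z s t) ω with hb
  set c : BondConfig V → ℝ := fun ω => rcWeightW w q ∅ ω * ind (patST z s t) ω with hc
  set d : BondConfig V → ℝ := fun ω => rcWeightW w q ∅ ω * ind (patZS z s t) ω with hd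
  set f : BondConfig V → ℝ := fun ω => rcWeightW w q ∅ ω * ind (patZT z s t) ω with hf
  have key : ∀ ω ω' : BondConfig V, rcWeightW w q ∅ ω * rcWeightW w q ∅ ω' * antipodalQ z s t ω ω' =
      a ω * b ω' + b ω * a ω' - c ω * d ω' - c ω * f ω' - d ω * c ω' - f ω * c ω' := by
    intro ω ω'; simp only [ha, hb, hc, hd, hf, antipodalQ]; ring
  have hδ : deltaMass w q z s t = (∑ ω, a ω) * (∑ ω, b ω) - (∑ ω, c ω) * ((∑ ω, d ω) + ∑ ω, f ω) := rfl
  rw [hδ, Finset.sum_congr rfl fun ω _ => Finset.sum_congr rfl fun ω' _ => key ω ω']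
  simp only [Finset.sum_add_distrib, Finset.sum_sub_distrib, ← Finset.sum_mul_sum]
  ring

/-! ### Step 2: regrouping the pairs `(ω, ω')` by `F = ω Δ ω'`, `ρ = ω ∩ ω'`, `X = ω ∖ ω'` -/

/-- Reindexing of a double sum over configurations by (symmetric difference, intersection, one-sided difference).
[folklore] -/
theorem sum_pairs_eq_sum_antipodal (g : BondConfig V → BondConfig V → ℝ) :
    (∑ ω : BondConfig V, ∑ ω' : BondConfig V, g ω ω') =
      ∑ F : BondConfig V, ∑ ρ : BondConfig V, ∑ X : BondConfig V,
        if Disjoint F ρ ∧ X ⊆ F then g (ρ ∪ X) (ρ ∪ (F \ X)) else 0 := by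
  have hL : (∑ ω : BondConfig V, ∑ ω' : BondConfig V, g ω ω') =
      ∑ p ∈ (Finset.univ : Finset (BondConfig V)) ×ˢ (Finset.univ : Finset (BondConfig V)), g p.1 p.2 := by
    rw [Finset.sum_product]
  have hR : (∑ F : BondConfig V, ∑ ρ : BondConfig V, ∑ X : BondConfig V,
        if Disjoint F ρ ∧ X ⊆ F then g (ρ ∪ X) (ρ ∪ (F \ X)) else 0) =
      ∑ tr ∈ (((Finset.univ : Finset (BondConfig V)) ×ˢ (Finset.univ : Finset (BondConfig V))) ×ˢ
          (Finset.univ : Finset (BondConfig V))).filter (fun tr => Disjoint tr.1.1 tr.1.2 ∧ tr.2 ⊆ tr.1.1),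
        g (tr.1.2 ∪ tr.2) (tr.1.2 ∪ (tr.1.1 \ tr.2)) := by
    rw [Finset.sum_filter, Finset.sum_product, Finset.sum_product]
  rw [hL, hR]
  symm
  refine Finset.sum_nbij' (fun tr => (tr.1.2 ∪ tr.2, tr.1.2 ∪ (tr.1.1 \ tr.2)))
    (fun pr => ((pr.1 \ pr.2 ∪ pr.2 \ pr.1, pr.1 ∩ pr.2), pr.1 \ pr.2)) ?_ ?_ ?_ ?_ ?_
  · intro tr _; simp
  · rintro ⟨ω, ω'⟩ _
    simp only [Finset.mem_filter, Finset.mem_product, Finset.mem_univ, true_and]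
    refine ⟨?_, ?_⟩
    · rw [Set.disjoint_left]
      rintro e (⟨he, hne⟩ | ⟨he, hne⟩) ⟨h1, h2⟩
      · exact hne h2
      · exact hne h1
    · exact Set.subset_union_left
  · rintro ⟨⟨F, ρ⟩, X⟩ ha
    simp only [Finset.mem_filter, Finset.mem_product, Finset.mem_univ, true_and] at ha
    obtain ⟨hdj, hX⟩ := ha
    rw [Set.disjoint_left] at hdj
    have e1 : (ρ ∪ X) \ (ρ ∪ F \ X) = X := by
      ext e; simp only [Set.mem_sdiff, Set.mem_union]
      constructor
      · intro h; rcases h.1 with h1 | h1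
        · exact (h.2 (Or.inl h1)).elim
        · exact h1
      · intro h; exact ⟨Or.inr h, fun h' => h'.elim (fun hρ => hdj (hX h) hρ) fun hF => hF.2 h⟩
    have e2 : (ρ ∪ F \ X) \ (ρ ∪ X) = F \ X := by
      ext e; simp only [Set.mem_sdiff, Set.mem_union]
      constructor
      · intro h; rcases h.1 with h1 | h1
        · exact (h.2 (Or.inl h1)).elim
        · exact ⟨h1.1, fun hx => h.2 (Or.inr hx)⟩
      · intro h; exact ⟨Or.inr h, fun h' => h'.elim (fun hρ => hdj h.1 hρ) fun hx => h.2 hx⟩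
    have e3 : (ρ ∪ X) ∩ (ρ ∪ F \ X) = ρ := by
      ext e; simp only [Set.mem_inter_iff, Set.mem_union, Set.mem_sdiff]
      constructor
      · rintro ⟨h | h, h' | h'⟩
        · exact h
        · exact h
        · exact h'
        · exact (h'.2 h).elim
      · intro h; exact ⟨Or.inl h, Or.inl h⟩
    have e4 : X ∪ F \ X = F := by
      ext e; simp only [Set.mem_union, Set.mem_sdiff]
      constructor
      · rintro (h | h)
        · exact hX h
        · exact h.1
      · intro h; by_cases hx : e ∈ X
        · exact Or.inl hx
        · exact Or.inr ⟨h, hx⟩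
    simp only [e1, e2, e3, e4]
  · rintro ⟨ω, ω'⟩ _
    have e5 : ω ∩ ω' ∪ ω \ ω' = ω := by
      ext e; simp only [Set.mem_union, Set.mem_inter_iff, Set.mem_sdiff]; tauto
    have e6 : ω ∩ ω' ∪ (ω \ ω' ∪ ω' \ ω) \ (ω \ ω') = ω' := by
      ext e; simp only [Set.mem_union, Set.mem_inter_iff, Set.mem_sdiff]; tauto
    simp only [e5, e6]
  · intro tr _
    rfl

/-! ### Step 3: the weights of an antipodal pair factor through `c_w(F,ρ)` -/

/-- For disjoint `F, ρ` and `X ⊆ F`: `w_q(ρ ∪ X)·w_q(ρ ∪ (F∖X)) = c_w(F,ρ)·q^{k(ρ∪X)+k(ρ∪(F∖X))}`. [cite: Grimmett2006, §1.4 eq. (1.20) (p. 15)] -/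
theorem rcWeightW_mul_antipodal (q : ℝ) {F ρ X : BondConfig V} (hd : Disjoint F ρ) (hX : X ⊆ F) :
    rcWeightW w q ∅ (ρ ∪ X) * rcWeightW w q ∅ (ρ ∪ (F \ X)) =
      antipodalCoef w F ρ * q ^ (clusterCount (ρ ∪ X) ∅ + clusterCount (ρ ∪ (F \ X)) ∅) := by
  rw [Set.disjoint_left] at hd
  have hw : weight (fun e => (w e : ℝ)) (ρ ∪ X) * weight (fun e => (w e : ℝ)) (ρ ∪ (F \ X)) = antipodalCoef w F ρ := by
    unfold weight antipodalCoef
    rw [← Finset.prod_mul_distrib]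
    refine Finset.prod_congr rfl fun e _ => ?_
    by_cases hF : e ∈ F
    · have hρ : e ∉ ρ := fun h => hd hF h
      by_cases hx : e ∈ X
      · have h1 : e ∈ ρ ∪ X := Or.inr hx
        have h2 : e ∉ ρ ∪ F \ X := fun h => h.elim hρ fun h' => h'.2 hx
        rw [if_pos h1, if_neg h2, if_pos hF]
      · have h1 : e ∉ ρ ∪ X := fun h => h.elim hρ hx
        have h2 : e ∈ ρ ∪ F \ X := Or.inr ⟨hF, hx⟩
        rw [if_neg h1, if_pos h2, if_pos hF, mul_comm]
    · by_cases hρ : e ∈ ρ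
      · have h1 : e ∈ ρ ∪ X := Or.inl hρ
        have h2 : e ∈ ρ ∪ F \ X := Or.inl hρ
        rw [if_pos h1, if_pos h2, if_neg hF, if_pos hρ, sq]
      · have hx : e ∉ X := fun h => hF (hX h)
        have h1 : e ∉ ρ ∪ X := fun h => h.elim hρ hx
        have h2 : e ∉ ρ ∪ F \ X := fun h => h.elim hρ fun h' => hF h'.1
        rw [if_neg h1, if_neg h2, if_neg hF, if_neg hρ, sq]
  unfold rcWeightW
  rw [← hw, pow_add]; ring

/-! ### Step 4: the identity and the reduction -/

/-- **Polar (antipodal) expansion of `δ`**: `2δ_w = ∑_{F,ρ disjoint} c_w(F,ρ)·T_q(z,s,t;F,ρ)`.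
[cite: AyyerLinussonRavichandran2025, §7 (p. 22)] [cite: Grimmett2006, §1.4 eq. (1.20) (p. 15)] -/
theorem two_mul_deltaMass_eq_sum_antipodal (q : ℝ) (z s t : V) :
    2 * deltaMass w q z s t =
      ∑ F : BondConfig V, ∑ ρ : BondConfig V,
        if Disjoint F ρ then antipodalCoef w F ρ * antipodalT q z s t F ρ else 0 := by
  rw [two_mul_deltaMass_eq_double_sum, sum_pairs_eq_sum_antipodal]
  refine Finset.sum_congr rfl fun F _ => Finset.sum_congr rfl fun ρ _ => ?_
  by_cases hd : Disjoint F ρ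
  · rw [if_pos hd, antipodalT, Finset.mul_sum]
    refine Finset.sum_congr rfl fun X _ => ?_
    by_cases hX : X ⊆ F
    · rw [if_pos ⟨hd, hX⟩, if_pos hX, rcWeightW_mul_antipodal w q hd hX]; ring
    · rw [if_neg (fun h => hX h.2), if_neg hX, mul_zero]
  · rw [if_neg hd]
    exact Finset.sum_eq_zero fun X _ => if_neg fun h => hd h.1

/-- **Reduction**: antipodal nonnegativity on `V` at `q` gives `δ_w ≥ 0` for EVERY weight vector `w` on `V`.
[cite: AyyerLinussonRavichandran2025, §7 (p. 22)] -/
theorem deltaMass_nonneg_of_antipodalTOn {q : ℝ} (h : AntipodalTOn V q) (z s t : V) : 0 ≤ deltaMass w q z s t := by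
  have h2 : 0 ≤ 2 * deltaMass w q z s t := by
    rw [two_mul_deltaMass_eq_sum_antipodal]
    refine Finset.sum_nonneg fun F _ => Finset.sum_nonneg fun ρ _ => ?_
    by_cases hd : Disjoint F ρ
    · rw [if_pos hd]; exact mul_nonneg (antipodalCoef_nonneg w F ρ) (h z s t F ρ hd)
    · rw [if_neg hd]
  linarith

/-! ### Step 5: from `δ ≥ 0` to the hub inequality and to the positive correlation of `{s ↔ t}` and `{z ↔ s} ∪ {z ↔ t}` -/

omit [Fintype V] in
/-- Pointwise pattern bookkeeping: the indicators of `{t ↔ s}`, `{z ↔ s}`, `{z ↔ s} ∩ {t ↔ s}`, `{s ↔ t}`,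
`{z ↔ s} ∪ {z ↔ t}`, `{s ↔ t} ∩ ({z ↔ s} ∪ {z ↔ t})` and `1` in terms of the five pattern indicators. [folklore] -/
theorem ind_patterns (z s t : V) (ω : BondConfig V) :
    ind (openConn t s) ω = ind (patST z s t) ω + ind (patAll z s t) ω ∧
    ind (openConn z s) ω = ind (patZS z s t) ω + ind (patAll z s t) ω ∧
    ind (openConn z s ∩ openConn t s) ω = ind (patAll z s t) ω ∧
    ind (openConn s t) ω = ind (patST z s t) ω + ind (patAll z s t) ω ∧
    ind (openConn z s ∪ openConn z t) ω = ind (patZS z s t) ω + ind (patZT z s t) ω + ind (patAll z s t) ω ∧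
    ind (openConn s t ∩ (openConn z s ∪ openConn z t)) ω = ind (patAll z s t) ω ∧
    (1 : ℝ) = ind (patSep z s t) ω + ind (patST z s t) ω + ind (patZS z s t) ω + ind (patZT z s t) ω + ind (patAll z s t) ω := by
  have hts : ω ∈ openConn t s ↔ ω ∈ openConn s t := ⟨fun h => SimpleGraph.Reachable.symm h, fun h => SimpleGraph.Reachable.symm h⟩
  by_cases hzs : ω ∈ openConn z s <;> by_cases hzt : ω ∈ openConn z t
  · have hst : ω ∈ openConn s t := SimpleGraph.Reachable.trans (SimpleGraph.Reachable.symm hzs) hzt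
    simp [ind, patSep, patST, patZS, patZT, patAll, hzs, hzt, hst, hts]
  · have hst : ω ∉ openConn s t := fun h => hzt (SimpleGraph.Reachable.trans hzs h)
    simp [ind, patSep, patST, patZS, patZT, patAll, hzs, hzt, hst, hts]
  · have hst : ω ∉ openConn s t := fun h => hzs (SimpleGraph.Reachable.trans hzt (SimpleGraph.Reachable.symm h))
    simp [ind, patSep, patST, patZS, patZT, patAll, hzs, hzt, hst, hts]
  · by_cases hst : ω ∈ openConn s t
    · simp [ind, patSep, patST, patZS, patZT, patAll, hzs, hzt, hst, hts]
    · simp [ind, patSep, patST, patZS, patZT, patAll, hzs, hzt, hst, hts]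

/-- Masses of the connection events in terms of the five pattern masses, and `Z = ∑ᵢ Sᵢ`. [folklore] -/
theorem patMass_patterns (q : ℝ) (z s t : V) :
    patMass w q (openConn t s) = patMass w q (patST z s t) + patMass w q (patAll z s t) ∧
    patMass w q (openConn z s) = patMass w q (patZS z s t) + patMass w q (patAll z s t) ∧
    patMass w q (openConn z s ∩ openConn t s) = patMass w q (patAll z s t) ∧
    patMass w q (openConn s t) = patMass w q (patST z s t) + patMass w q (patAll z s t) ∧
    patMass w q (openConn z s ∪ openConn z t) = patMass w q (patZS z s t) + patMass w q (patZT z s t) + patMass w q (patAll z s t) ∧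
    patMass w q (openConn s t ∩ (openConn z s ∪ openConn z t)) = patMass w q (patAll z s t) ∧
    rcPartitionFunctionW w q ∅ = patMass w q (patSep z s t) + patMass w q (patST z s t) + patMass w q (patZS z s t) +
      patMass w q (patZT z s t) + patMass w q (patAll z s t) := by
  simp only [patMass, rcPartitionFunctionW, ← Finset.sum_add_distrib, ← mul_add]
  refine ⟨?_, ?_, ?_, ?_, ?_, ?_, ?_⟩ <;> refine Finset.sum_congr rfl fun ω _ => ?_ <;>
    obtain ⟨h1, h2, h3, h4, h5, h6, h7⟩ := ind_patterns z s t ω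
  · rw [h1]
  · rw [h2]
  · rw [h3]
  · rw [h4]
  · rw [h5]
  · rw [h6]
  · rw [← h7, mul_one]

/-- Masses are nonnegative (`0 ≤ q`). [cite: Grimmett2006, §1.4 eq. (1.20) (p. 15)] -/
theorem patMass_nonneg {q : ℝ} (hq : 0 ≤ q) (A : Set (BondConfig V)) : 0 ≤ patMass w q A :=
  Finset.sum_nonneg fun ω _ => mul_nonneg (rcWeightW_nonneg w hq ∅ ω) (ind_nonneg A ω)

/-- **The hub inequality from antipodal nonnegativity**: `AntipodalTOn V q` gives ALR (14)
`φ(z ↔ s)·φ(t ↔ s) ≤ φ(z ↔ s ↔ t)` (`HubUnder`) for EVERY `φ_{w,q}` on `V`. [cite: AyyerLinussonRavichandran2025, §7 eq. (13)–(14) (p. 22)] -/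
theorem hubUnder_of_antipodalTOn {q : ℝ} (hq : 0 < q) (h : AntipodalTOn V q) (z s t : V) :
    HubUnder (rcMeasureW w q ∅) z s t := by
  have hδ := deltaMass_nonneg_of_antipodalTOn w h z s t
  obtain ⟨m1, m2, m3, -, -, -, mZ⟩ := patMass_patterns w q z s t
  have h0 := patMass_nonneg w hq.le (patSep z s t)
  have h1 := patMass_nonneg w hq.le (patST z s t)
  have h2 := patMass_nonneg w hq.le (patZS z s t)
  have h3 := patMass_nonneg w hq.le (patZT z s t)
  have h4 := patMass_nonneg w hq.le (patAll z s t)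
  unfold deltaMass at hδ
  refine real_mul_le_of_mass w hq (openConn z s) (openConn t s) ?_
  change patMass w q (openConn z s) * patMass w q (openConn t s) ≤ rcPartitionFunctionW w q ∅ * patMass w q (openConn z s ∩ openConn t s)
  rw [m1, m2, m3, mZ]
  nlinarith [mul_nonneg h1 h3, mul_nonneg h3 h4]

/-- **The sharp consequence**: `AntipodalTOn V q` gives the positive correlation of `{s ↔ t}` and `{z ↔ s} ∪ {z ↔ t}`,
`φ(s ↔ t)·φ(z ↔ {s,t}) ≤ φ(Ω)·φ(s ↔ t, z ↔ {s,t})`, for every `φ_{w,q}` on `V` (equivalent to `δ ≥ 0`).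
[cite: AyyerLinussonRavichandran2025, §7 (p. 22)] -/
theorem real_conn_union_le_of_antipodalTOn {q : ℝ} (hq : 0 < q) (h : AntipodalTOn V q) (z s t : V) :
    (rcMeasureW w q ∅).real (openConn s t) * (rcMeasureW w q ∅).real (openConn z s ∪ openConn z t) ≤
      (rcMeasureW w q ∅).real univ * (rcMeasureW w q ∅).real (openConn s t ∩ (openConn z s ∪ openConn z t)) := by
  have hδ := deltaMass_nonneg_of_antipodalTOn w h z s t
  obtain ⟨-, -, -, m4, m5, m6, mZ⟩ := patMass_patterns w q z s t
  unfold deltaMass at hδ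
  refine real_mul_le_of_mass w hq (openConn s t) (openConn z s ∪ openConn z t) ?_
  change patMass w q (openConn s t) * patMass w q (openConn z s ∪ openConn z t) ≤
    rcPartitionFunctionW w q ∅ * patMass w q (openConn s t ∩ (openConn z s ∪ openConn z t))
  rw [m4, m5, m6, mZ]
  nlinarith

/-- **Conjecture T implies the hub conjecture node**: `AntipodalTPos → HubFKPos` (ALR (13)/(14) for every `q > 0`).
[cite: AyyerLinussonRavichandran2025, §7 eq. (13)–(15), Conj. 7.1 (p. 22)] -/
theorem hubFKPos_of_antipodalTPos (h : AntipodalTPos) : HubFKPos :=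
  fun q hq n w o a b => hubUnder_of_antipodalTOn w hq (h q hq n) o a b

end FK

end Summit.CriticalPhenomena.PercolationContinuityZ3.Theorems
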